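import Literature.MathematicalPhysics.QuantumFieldTheory.Balaban1983to89.B9Eq321LandauOrthogonalZdPer
import Literature.MathematicalPhysics.QuantumFieldTheory.Balaban1983to89.B9Eq321LandauMultiplierIffZd
import Literature.MathematicalPhysics.QuantumFieldTheory.Balaban1983to89.B9B8KnitLetterPeriodic

/-!
# `Balaban1983to89.B9Eq321LandauMultiplierIffZdPer` — [Balaban1985RegularSpaces] (1.38) p. 82 ∕ [Balaban1985BackgroundPropagators] (3.20)–(3.21) p. 394
# ON THE TORUS `T_P` READ ON `ℤᵈ`: THE RECORD's MULTIPLIER FORM OF THE LANDAU CONDITION AT `Ω₀ = ℤᵈ` IS **EQUIVALENT** TO PRINT's ORTHOGONALITY FORM —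
# `IsLandau138 L m η Set.univ Λs U₀ A` ⟺ «`Σ_{x∈[0,P)ᵈ} τ((Δ^η_{U₀}λ)(x)·(D^{η*}_{U₀}A)(x)) = 0` for every PERIODIC `λ ∈ N^per(Q′(U₀))`» — at EVERY periodic
# background of units, for `P`-periodic `A`, `Lᵐ ∣ P`, level-periodic constraint sets `Λ_j` and a finite-dimensional fibre with a non-degenerate trace pairing
# `τ(ab)`; the direction ⇐ is finite-dimensional duality on the periodic functions (`(N^per)^⊥ = W^⊥⊥ = W`), the periodic twin of `B9Eq321LandauMultiplierIffZd`

statement-level skeleton of published theorems with citation tags; proofs where landed; nothing here is a claim about the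
Yang–Mills mass gap

`[Balaban1985RegularSpaces]` ("B8", CMP **99** (1985) 75–102) (1.38) p. 82 *«R(U₀)D^{η*}_{U₀}A = 0»*, p. 77 *«we admit the case when some domains Ω_j are equal
to T_η»*; `[Balaban1985BackgroundPropagators]` ("B9", CMP **99** (1985) 389–434) p. 394 (3.21) *«R = Δ^η_U N(Q′), N(Q′) = {λ : Q′λ = 0}»*, (3.19) p. 393, (3.24)
p. 394, p. 391 *«X·Y = tr XY»*.  PDF held: `paper:balaban1985-cmp99-background-propagators` pp. 391–395.

CITATION HEADER (lean-in-tree rule).  Cell `pub-ymgap` (YM Track A), DAG node N06 = [B9], width seat `pub-ymgap-dag-n06-w4` (g6), the (β′-PERIODIC) road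
(director-ym №217 (1) ∕ plan g86 PENS-217).  WHY: the N05 family of record and its periodic member model (`B8LeafModelZd3.zdGF3` ∕ `B8LeafModelZdPer.zdGF3Per`)
state the Landau gauge condition in MULTIPLIER form AT `Ω₀ = ℤᵈ` (`IsLandau138 L m η (i.Ω 0) (i.Λs m) U₀ A`, `i.Ω 0 = univ`).  The companion file
`B9Eq321LandauOrthogonalZdPer` (this seat, g6) proves multiplier ⇒ orthogonality on the period cell; THIS FILE proves the CONVERSE by finite-dimensional
linear algebra on the `P`-periodic functions, so that on the torus the record's text IS print's «R(U₀)D^{η*}_{U₀}A = 0» — with NO (3.25)-inverse ∕ Thm 3.11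
in the identification (`B8Eq138Multiplier` makes it modulo those inverses).  Mechanism: on `E = {f : ℤᵈ → 𝔸  P-periodic}` (finite-dimensional: the torus
`(ℤ∕P)ᵈ` times the fibre) with the symmetric non-degenerate pairing `⟨f, g⟩ = Σ_{x∈[0,P)ᵈ} τ(f(x)g(x))`, the PERIODIC multiplier transposes `Q′(U₀)ᵀμ`
(level-`j` multiplier `(P∕Lʲ)`-periodic) form a subspace `W` whose orthogonal IS `N^per(Q′(U₀))` (the cell transpose identity of the companion file +
non-degeneracy, testing against periodic one-class multipliers), hence `(N^per)^⊥ = W^⊥⊥ = W` (Mathlib `LinearMap.BilinForm.orthogonal_orthogonal`);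
and `Δ^η_{U₀}D^{η*}_{U₀}A ∈ (N^per)^⊥` is the orthogonality form by the `τ`-symmetry of `Δ^η_{U₀}` on the cell.  Nothing is re-declared: `trPair`,
`QT_add ∕ QT_smul` (the Dirichlet twin), the cell transposes `sum_box_pair_QT ∕ sum_box_pair_covLap_symm` (companion), `QprimeT_shiftCfg` ∕
`QprimeIter_bgT_shiftCfg` (translation covariance, seats dag-n05-a ∕ dag-n05-c) are imported BY NAME.

WHAT IS DECLARED ∕ PROVED (kernel, 0 sorry; 4 plumbing `def`s + theorems; no `instance`, no `notation`).
* §1 `perSubC P` (the COMPLEX subspace of `P`-periodic functions `ℤᵈ → 𝔸`; `finiteDimensional_perSubC`), `pairPer τ P` (= `trPair τ (box P)` restricted: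
  `Σ_{x∈[0,P)ᵈ} τ(f(x)g(x))`), `pairPer_isSymm` (τ tracial), `pdelta P x b` (the periodic one-class function `𝟙_{[x]}·b`), `isPeriodic_pdelta`,
  `sum_box_trace_mul_pdelta` (testing against it reads `τ(f(x)b)`), ★ `pairPer_nondegenerate` (τ non-degenerate: `(∀ b, τ(ab) = 0) → a = 0`).
* §2 (translation covariance ⟹ periodicity of the transposes) `isPeriodic_QprimeIter` (`λ`, `U₀` `P`-periodic, `P = Lʲ·Q` ⟹ `Q′_j(U₀)λ` is `Q`-periodic on the
  level-`j` lattice), `isPeriodic_QprimeT` (`ν` `Q`-periodic ⟹ `Q′_jᵀν` is `P`-periodic), `isPeriodic_indicator`, ★ `isPeriodic_QT` (level-periodic `Λ_j`, `μ_j`,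
  `Lᵐ ∣ P` ⟹ `Q′(U₀)ᵀμ` is `P`-periodic), `mem_iff_tlift_mem_of_isPeriodic` (a periodic set is read on representatives).
* §3 `multSubPer` (= `W`: the periodic functions EQUAL to some `Q′(U₀)ᵀμ` with level-periodic `μ`), `nullSubPer` (= `N^per(Q′(U₀))`: periodic `λ` with
  `Q′_j(U₀)λ = 0` on `Λ_j`, `j ≤ m`), `sum_box_trace_mul_QT` (the cell transpose for the pairing `τ(ab)`), ★★ `nullSubPer_eq_orthogonal_multSubPer` (`N^per = W^⊥`).
* §4 ★★ `isLandau138_univ_of_orthogonal` (orthogonality form on the cell ⇒ multiplier form at `Ω₀ = ℤᵈ`, with a LEVEL-PERIODIC multiplier) and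
  ★★★ `isLandau138_univ_iff_orthogonal` (the EQUIVALENCE at every periodic background of units).

HONEST SCOPE.  (i) Finite-dimensional linear algebra; no estimate; no inverse of [B9] is used or constructed.  (ii) The orthogonality form is the
complex-BILINEAR one of the tracial pairing `τ(ab)` over ALL `𝔸`-valued periodic `λ ∈ N^per(Q′(U₀))` (the currency in which the companion file's theorem holds at
every background of units); at a unitary `U₀` on Hermitian data it is print's Hilbert-space statement on `L²(T_P, 𝔤)` (companion §5, `projEPer`).  (iii) HYPOTHESES
beyond the Dirichlet twin: `Lᵐ ∣ P` (print's: the block lattices divide the torus, [B8] p. 77) and LEVEL-PERIODIC constraint sets `Λ_j` (`(P∕Lʲ)`-periodic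
membership; on the torus members of record `Λ_j ∈ {∅, ℤᵈ}` — `B8Thm4TorusAt.torusLam` — this is no condition); they make the multiplier transposes periodic,
which is how a multiplier found on the cell becomes one on all of `ℤᵈ`.  (iv) Count-neutral; N05 ∕ N06 NOT discharged; K1⁹ `stmt-QuantumFields-27364` NOT
closed; one finite `𝕋⁴` programme at fixed `ε`, Bałaban as printed; R4 closes only the conditional finite-`𝕋⁴` rung `BalabanLadder.UV` — nothing continuum ∕ ℝ⁴ ∕
OS ∕ mass gap ∕ Clay.  Unit `pub-ymgap-dag-n06-w4` (g6), 2026-08-28.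
-/

noncomputable section

namespace Literature.MathematicalPhysics.QuantumFieldTheory.Balaban1983to89.B9Eq321LandauMultiplierIffZdPer

open B7Prop1Explicit B7Eq78Linearization
open B8Ineq132 (covDeriv covDerivFwd)
open B8Eq119TwistedAxial (bgT)
open B8Eq138LandauZd (covDivB covLap qprimeT1 QprimeT QT IsLandau138)
open B12Ineq417Flat (shiftCfg shiftCfg_apply)
open T4TermwiseTorus (IsPeriodic box mem_box tcls tlift tcls_add tcls_period tlift_mem_box tlift_tcls_of_mem_box tcls_injOn_box tcls_eq_tcls_iff)
open B9Eq321LandauMultiplierIffZd (trPair trPair_apply QT_add QT_smul)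
open B9Eq321LandauOrthogonalZdPer (sum_box_pair_QT sum_box_pair_covLap_symm sum_box_trace_covLap_mul_covDivB_eq_zero_of_isLandau138)

-- `Site` alone could resolve to the torus sites of `Setup.lean`; re-export the `ℤ^d` sites of `B7Prop1Explicit`.
export B7Prop1Explicit (Site)

variable {d : ℕ} {𝔸 : Type*} [CStarAlgebra 𝔸]

/-! ## §1  The complex pairing space of `P`-periodic functions: `⟨f, g⟩ = Σ_{x∈[0,P)ᵈ} τ(f(x)g(x))` -/

section Space

variable (τ : 𝔸 →ₗ[ℂ] ℂ) (P : ℕ)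

/-- `P`-periodic functions `ℤᵈ → 𝔸` (the torus `T_P` read on its universal cover), as a COMPLEX subspace. [cite: Balaban1985BackgroundPropagators, (3.21) p.394 («L²(Ω₀, 𝔤)»); Balaban1985RegularSpaces, p.77 («Ω_j = T_η»)] -/
def perSubC : Submodule ℂ (Site d → 𝔸) where
  carrier := {f | IsPeriodic P f}
  add_mem' := by
    intro f g hf hg x n
    rw [Pi.add_apply, Pi.add_apply, hf x n, hg x n]
  zero_mem' := fun _ _ => rfl
  smul_mem' := by
    intro c f hf x n
    rw [Pi.smul_apply, Pi.smul_apply, hf x n]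

/-- restriction to the cell `[0,P)ᵈ` is injective on periodic functions, so `perSubC P` is finite-dimensional over `ℂ` when the fibre is (`P ≠ 0`).
[cite: Balaban1985RegularSpaces, p.77 («Ω₀ = T_η» is finite)] -/
theorem finiteDimensional_perSubC [FiniteDimensional ℂ 𝔸] [NeZero P] : FiniteDimensional ℂ (perSubC (𝔸 := 𝔸) (d := d) P) := by
  let res : (perSubC (𝔸 := 𝔸) (d := d) P) →ₗ[ℂ] ((↥(box (d := d) P)) → 𝔸) :=
    { toFun := fun f x => (f : Site d → 𝔸) x
      map_add' := fun f g => rfl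
      map_smul' := fun c f => rfl }
  refine FiniteDimensional.of_injective res fun f g h => ?_
  apply Subtype.ext
  funext x
  have hfg := congr_fun h ⟨tlift (tcls P x), tlift_mem_box _⟩
  have hf : (f : Site d → 𝔸) (tlift (tcls P x)) = (f : Site d → 𝔸) x := IsPeriodic.apply_tlift f.2 x
  have hg : (g : Site d → 𝔸) (tlift (tcls P x)) = (g : Site d → 𝔸) x := IsPeriodic.apply_tlift g.2 x
  rw [← hf, ← hg]
  exact hfg

/-- **THE TRACIAL PAIRING ON THE TORUS** `Σ_{x∈[0,P)ᵈ} τ(f(x)g(x))`: the Dirichlet twin's `trPair τ (box P)` restricted to the periodic functions (print's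
«⟨λ, λ′⟩ = Σ η^d tr λ(x)λ′(x)» over one fundamental domain, the positive weight dropped). [cite: Balaban1985BackgroundPropagators, (3.17) p.393, p.391 («X·Y = tr XY»); Balaban1985RegularSpaces, p.77] -/
def pairPer : LinearMap.BilinForm ℂ (perSubC (𝔸 := 𝔸) (d := d) P) := (trPair τ (box P)).restrict (perSubC P)

/-- the pairing unfolded. [cite: Balaban1985BackgroundPropagators, (3.17) p.393 (bookkeeping)] -/
theorem pairPer_apply (f g : perSubC (𝔸 := 𝔸) (d := d) P) :
    pairPer τ P f g = ∑ x ∈ box (d := d) P, τ ((f : Site d → 𝔸) x * (g : Site d → 𝔸) x) := rfl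

/-- **SYMMETRY** for a tracial `τ`. [cite: Balaban1985BackgroundPropagators, p.391 (tr XY = tr YX)] -/
theorem pairPer_isSymm (hτt : ∀ a b : 𝔸, τ (a * b) = τ (b * a)) : (pairPer τ (d := d) P).IsSymm :=
  ⟨fun f g => by
    rw [pairPer_apply, pairPer_apply]
    exact Finset.sum_congr rfl fun x _ => hτt _ _⟩

open Classical in
/-- **THE PERIODIC ONE-CLASS FUNCTION** `𝟙_{[x]}·b`: `b` on the torus class of `x`, `0` elsewhere (the periodic replacement of the Dirichlet twin's `δ_x·b`).
[cite: Balaban1985RegularSpaces, p.77 («Ω_j = T_η», bookkeeping)] -/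
def pdelta (x : Site d) (b : 𝔸) : Site d → 𝔸 := fun y => if tcls P y = tcls P x then b else 0

omit [CStarAlgebra 𝔸] in
/-- `pdelta P x b` is `P`-periodic. [cite: Balaban1985RegularSpaces, p.77 (bookkeeping)] -/
theorem isPeriodic_pdelta {𝔸 : Type*} [Zero 𝔸] (x : Site d) (b : 𝔸) :
    IsPeriodic P (fun y => if tcls P y = tcls P x then b else (0 : 𝔸)) := by
  intro y n
  simp only [tcls_add, tcls_period, add_zero]

/-- membership of `pdelta` in `perSubC`. [cite: Balaban1985RegularSpaces, p.77 (bookkeeping)] -/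
theorem pdelta_mem_perSubC (x : Site d) (b : 𝔸) : pdelta P x b ∈ perSubC (𝔸 := 𝔸) (d := d) P := by
  classical
  intro y n
  simp only [pdelta, tcls_add, tcls_period, add_zero]

/-- **TESTING AGAINST `𝟙_{[x]}·b` ON THE CELL READS `τ(f(x)b)`** for `x ∈ [0,P)ᵈ` (on the cell, equality of classes is equality).
[cite: Balaban1985RegularSpaces, p.77 («Ω_j = T_η», bookkeeping)] -/
theorem sum_box_trace_mul_pdelta [NeZero P] (f : Site d → 𝔸) {x : Site d} (hx : x ∈ box (d := d) P) (b : 𝔸) :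
    ∑ y ∈ box (d := d) P, τ (f y * pdelta P x b y) = τ (f x * b) := by
  classical
  rw [Finset.sum_eq_single x (fun y hy hyx => ?_) (fun h' => absurd hx h')]
  · simp [pdelta]
  · have hne : tcls P y ≠ tcls P x := fun h => hyx (tcls_injOn_box hy hx h)
    simp only [pdelta, if_neg hne, mul_zero, map_zero]

/-- ★ **NON-DEGENERACY OF THE TORUS PAIRING** for a non-degenerate trace pairing (`(∀ b, τ(ab) = 0) → a = 0`; print's `tr` on `M_N(ℂ)`) and `P ≠ 0`: testing
against the periodic one-class functions on the cell, and periodicity off the cell. [cite: Balaban1985BackgroundPropagators, (3.21) p.394 («the Hilbert space L²(Ω₀, 𝔤)»); Balaban1985RegularSpaces, p.77] -/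
theorem pairPer_nondegenerate [NeZero P] (hτt : ∀ a b : 𝔸, τ (a * b) = τ (b * a)) (hτn : ∀ a : 𝔸, (∀ b : 𝔸, τ (a * b) = 0) → a = 0) :
    (pairPer τ (d := d) P).Nondegenerate := by
  -- left separation; right separation follows by symmetry
  have hleft : ∀ f : perSubC (𝔸 := 𝔸) (d := d) P, (∀ g, pairPer τ P f g = 0) → f = 0 := by
    intro f hf
    apply Subtype.ext
    funext x
    have hfx : (f : Site d → 𝔸) (tlift (tcls P x)) = (f : Site d → 𝔸) x := IsPeriodic.apply_tlift f.2 x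
    rw [← hfx, Submodule.coe_zero, Pi.zero_apply]
    refine hτn _ fun b => ?_
    have h := hf ⟨pdelta P (tlift (tcls P x)) b, pdelta_mem_perSubC P _ b⟩
    rwa [pairPer_apply, sum_box_trace_mul_pdelta τ P _ (tlift_mem_box _) b] at h
  refine ⟨hleft, fun g hg => hleft g fun f => ?_⟩
  rw [(pairPer_isSymm τ P hτt).eq g f]
  exact hg f

end Space

/-! ## §2  Translation covariance ⟹ the averaging operators and their transposes preserve periodicity -/

section Periodic

variable {P L : ℕ} {U₀ : Site d → Fin d → 𝔸ˣ}

/-- **`Q′_j(U₀)λ` IS `Q`-PERIODIC** on the level-`j` lattice for `P`-periodic `λ`, `U₀` and `P = Lʲ·Q` (translation covariance of the iterated averaging (3.19),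
`B9B8KnitLetterPeriodic.QprimeIter_bgT_shiftCfg`). [cite: Balaban1985BackgroundPropagators, (3.19) p.393; Balaban1985RegularSpaces, p.77 («Ω_j = T_η»)] -/
theorem isPeriodic_QprimeIter (hU : IsPeriodic P U₀) {lam : Site d → 𝔸} (hlam : IsPeriodic P lam) {j Q : ℕ} (hPQ : P = L ^ j * Q) :
    IsPeriodic Q (QprimeIter (zdBlocking d L) (bgT L U₀) j lam) := by
  intro y n
  have h := B9B8KnitLetterPeriodic.QprimeIter_bgT_shiftCfg L U₀ j ((Q : ℤ) • n) lam y
  have hs : ((L : ℤ) ^ j) • ((Q : ℤ) • n) = (P : ℤ) • n := by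
    rw [smul_smul, hPQ]; push_cast; ring_nf
  have hU' : shiftCfg ((P : ℤ) • n) U₀ = U₀ := funext fun y => hU y n
  have hlam' : shiftCfg ((P : ℤ) • n) lam = lam := funext fun y => hlam y n
  rw [hs, hU', hlam'] at h
  exact h.symm

/-- **`Q′_j(U₀)ᵀν` IS `P`-PERIODIC** on the fine lattice for a `Q`-periodic level-`j` function `ν`, `P`-periodic `U₀`, `P = Lʲ·Q`, `L ≥ 1`
(`B8TorusShiftLandau.QprimeT_shiftCfg`). [cite: Balaban1985BackgroundPropagators, (3.19) p.393, (3.24) p.394; Balaban1985RegularSpaces, p.77] -/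
theorem isPeriodic_QprimeT (hL : 1 ≤ L) (hU : IsPeriodic P U₀) {j Q : ℕ} (hPQ : P = L ^ j * Q) {ν : Site d → 𝔸} (hν : IsPeriodic Q ν) :
    IsPeriodic P (QprimeT L U₀ j ν) := by
  intro x n
  have h := B8TorusShiftLandau.QprimeT_shiftCfg hL U₀ j ((Q : ℤ) • n) ν x
  have hs : ((L : ℤ) ^ j) • ((Q : ℤ) • n) = (P : ℤ) • n := by
    rw [smul_smul, hPQ]; push_cast; ring_nf
  have hU' : shiftCfg ((P : ℤ) • n) U₀ = U₀ := funext fun y => hU y n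
  have hν' : shiftCfg ((Q : ℤ) • n) ν = ν := funext fun y => hν y n
  rw [hs, hU', hν'] at h
  exact h.symm

omit [CStarAlgebra 𝔸] in
/-- the restriction `𝟙_Λ·μ` of a `Q`-periodic `μ` to a `Q`-periodic set `Λ` is `Q`-periodic. [cite: Balaban1985RegularSpaces, p.77 (bookkeeping)] -/
theorem isPeriodic_indicator {𝔸 : Type*} [Zero 𝔸] {Q : ℕ} {Λ : Set (Site d)} (hΛ : IsPeriodic Q fun y => y ∈ Λ) {μ : Site d → 𝔸}
    (hμ : IsPeriodic Q μ) : IsPeriodic Q (Λ.indicator μ) := by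
  classical
  intro y n
  simp only [Set.indicator_apply, hμ y n]
  have hm : (y + (Q : ℤ) • n ∈ Λ) = (y ∈ Λ) := hΛ y n
  rw [hm]

/-- the quotient `P ∕ Lʲ` for `Lᵐ ∣ P`, `j ≤ m`: `P = Lʲ·(P∕Lʲ)`. [cite: Balaban1985RegularSpaces, p.77 (bookkeeping: the block lattices divide the torus)] -/
theorem eq_pow_mul_div_of_dvd {m j : ℕ} (hP : L ^ m ∣ P) (hjm : j ≤ m) : P = L ^ j * (P / L ^ j) :=
  (Nat.mul_div_cancel' ((pow_dvd_pow L hjm).trans hP)).symm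

/-- ★ **`Q′(U₀)ᵀμ` IS `P`-PERIODIC** for LEVEL-PERIODIC data: `U₀` `P`-periodic, `Lᵐ ∣ P`, `L ≥ 1`, and for `j ≤ m` the constraint set `Λ_j` and the multiplier
`μ_j` `(P∕Lʲ)`-periodic. [cite: Balaban1985BackgroundPropagators, (3.24) p.394, (3.19) p.393; Balaban1985RegularSpaces, (1.38) p.82, p.77 («Ω_j = T_η»)] -/
theorem isPeriodic_QT (hL : 1 ≤ L) (hU : IsPeriodic P U₀) {m : ℕ} (hP : L ^ m ∣ P) {Λs : ℕ → Set (Site d)}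
    (hΛ : ∀ j, j ≤ m → IsPeriodic (P / L ^ j) fun y => y ∈ Λs j) {μ : ℕ → Site d → 𝔸} (hμ : ∀ j, j ≤ m → IsPeriodic (P / L ^ j) (μ j)) :
    IsPeriodic P (QT L m Λs U₀ μ) := by
  intro x n
  simp only [QT]
  refine Finset.sum_congr rfl fun j hj => ?_
  have hjm : j ≤ m := Nat.lt_succ_iff.1 (Finset.mem_range.1 hj)
  exact isPeriodic_QprimeT hL hU (eq_pow_mul_div_of_dvd hP hjm) (isPeriodic_indicator (hΛ j hjm) (hμ j hjm)) x n

omit [CStarAlgebra 𝔸] in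
/-- a periodic set is read on representatives: `y ∈ Λ ⟺ ȳ ∈ Λ` (`ȳ ∈ [0,Q)ᵈ` the representative of `y mod Q`). [cite: Balaban1985RegularSpaces, p.77 (bookkeeping)] -/
theorem mem_iff_tlift_mem_of_isPeriodic {Q : ℕ} [NeZero Q] {Λ : Set (Site d)} (hΛ : IsPeriodic Q fun y => y ∈ Λ) (y : Site d) :
    y ∈ Λ ↔ tlift (tcls Q y) ∈ Λ := by
  have h : (tlift (tcls Q y) ∈ Λ) = (y ∈ Λ) := IsPeriodic.apply_tlift hΛ y
  rw [h]

end Periodic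

/-! ## §3  `W = {Q′(U₀)ᵀμ : μ level-periodic}` and `N^per(Q′(U₀))`; `N^per = W^⊥` -/

section LevelPeriodic

variable (P L m : ℕ)

/-- sums of level-periodic multipliers are level-periodic. [folklore] -/
private theorem levelPeriodic_add {μ μ' : ℕ → Site d → 𝔸} (hμ : ∀ j, j ≤ m → IsPeriodic (P / L ^ j) (μ j))
    (hμ' : ∀ j, j ≤ m → IsPeriodic (P / L ^ j) (μ' j)) : ∀ j, j ≤ m → IsPeriodic (P / L ^ j) ((μ + μ') j) := by
  intro j hj y n
  simp only [Pi.add_apply, hμ j hj y n, hμ' j hj y n]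

/-- scalar multiples of level-periodic multipliers are level-periodic. [folklore] -/
private theorem levelPeriodic_smul (c : ℂ) {μ : ℕ → Site d → 𝔸} (hμ : ∀ j, j ≤ m → IsPeriodic (P / L ^ j) (μ j)) :
    ∀ j, j ≤ m → IsPeriodic (P / L ^ j) ((c • μ) j) := by
  intro j hj y n
  simp only [Pi.smul_apply, hμ j hj y n]

end LevelPeriodic

section Subspaces

variable (τ : 𝔸 →ₗ[ℂ] ℂ) (P L m : ℕ) [NeZero L] (Λs : ℕ → Set (Site d)) (U₀ : Site d → Fin d → 𝔸ˣ)

/-- **`W`**: the periodic functions EQUAL (on all of `ℤᵈ`) to some multiplier transpose `Q′(U₀)ᵀμ` with LEVEL-PERIODIC `μ` (`μ_j` `(P∕Lʲ)`-periodic, `j ≤ m`) —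
the right-hand sides of (1.38)'s record form on the torus. [cite: Balaban1985BackgroundPropagators, (3.24) p.394; Balaban1985RegularSpaces, (1.38) p.82, p.77] -/
def multSubPer : Submodule ℂ (perSubC (𝔸 := 𝔸) (d := d) P) where
  carrier := {g | ∃ μ : ℕ → Site d → 𝔸, (∀ j, j ≤ m → IsPeriodic (P / L ^ j) (μ j)) ∧ ∀ x, (g : Site d → 𝔸) x = QT L m Λs U₀ μ x}
  add_mem' := by
    rintro g g' ⟨μ, hμp, hμ⟩ ⟨μ', hμp', hμ'⟩
    refine ⟨μ + μ', levelPeriodic_add P L m hμp hμp', fun x => ?_⟩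
    rw [Submodule.coe_add, Pi.add_apply, hμ x, hμ' x, QT_add]
  zero_mem' := ⟨fun _ _ => 0, fun _ _ _ _ => rfl, fun x => by
    rw [Submodule.coe_zero, Pi.zero_apply, B8Eq138LandauZd.QT_zero]⟩
  smul_mem' := by
    rintro c g ⟨μ, hμp, hμ⟩
    refine ⟨c • μ, levelPeriodic_smul P L m c hμp, fun x => ?_⟩
    rw [Submodule.coe_smul, Pi.smul_apply, hμ x, QT_smul]

/-- **`N^per(Q′(U₀))`** in the periodic functions: `Q′_j(U₀)λ = 0` on `Λs j`, `j ≤ m` («N(Q′) = {λ : Q′λ = 0}», (3.21), `Ω₀ = T_η`).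
[cite: Balaban1985BackgroundPropagators, (3.21) p.394, (3.19) p.393; Balaban1985RegularSpaces, p.77] -/
def nullSubPer : Submodule ℂ (perSubC (𝔸 := 𝔸) (d := d) P) where
  carrier := {lam | ∀ j, j ≤ m → ∀ y ∈ Λs j, QprimeIter (zdBlocking d L) (bgT L U₀) j (lam : Site d → 𝔸) y = 0}
  add_mem' := by
    intro f g hf hg j hj y hy
    rw [Submodule.coe_add]
    have h := congr_fun (QprimeIter_add (zdBlocking d L) (bgT L U₀) (f : Site d → 𝔸) (g : Site d → 𝔸) j) y
    rw [show ((f : Site d → 𝔸) + (g : Site d → 𝔸)) = fun x => (f : Site d → 𝔸) x + (g : Site d → 𝔸) x from rfl, h,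
      hf j hj y hy, hg j hj y hy, add_zero]
  zero_mem' := fun j _ y _ => by
    rw [Submodule.coe_zero]
    exact B8Eq138LandauZd.QprimeIter_zero_fun L U₀ j y
  smul_mem' := by
    intro c f hf j hj y hy
    rw [Submodule.coe_smul]
    have h := congr_fun (QprimeIter_smul (zdBlocking d L) (bgT L U₀) c (f : Site d → 𝔸) j) y
    rw [show (c • (f : Site d → 𝔸)) = fun x => c • (f : Site d → 𝔸) x from rfl, h, hf j hj y hy, smul_zero]

variable {τ P L m Λs U₀}

/-- **THE CELL TRANSPOSE FOR THE PAIRING `τ(ab)`**: for `Lᵐ ∣ P`, `Σ_{x∈[0,P)ᵈ} τ(λ(x)·(Q′(U₀)ᵀμ)(x)) = Σ_{j ≤ m} Σ_{y∈[0,P∕Lʲ)ᵈ} τ((Q′_j(U₀)λ)(y)·𝟙_{Λ_j}(y)μ_j(y))`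
(the companion file's `sum_box_pair_QT` for the all-units-invariant pairing `τ(ab)`; no periodicity needed). [cite: Balaban1985BackgroundPropagators, (3.19) p.393, (3.24) p.394] -/
theorem sum_box_trace_mul_QT (hτt : ∀ a b : 𝔸, τ (a * b) = τ (b * a)) (hP : L ^ m ∣ P) (lam : Site d → 𝔸) (μ : ℕ → Site d → 𝔸) :
    ∑ x ∈ box (d := d) P, τ (lam x * QT L m Λs U₀ μ x) =
      ∑ j ∈ Finset.range (m + 1), ∑ y ∈ box (d := d) (P / L ^ j),
        τ (QprimeIter (zdBlocking d L) (bgT L U₀) j lam y * (Λs j).indicator (μ j) y) := by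
  have key := sum_box_pair_QT ((LinearMap.mul ℝ 𝔸).compr₂ (τ.restrictScalars ℝ)) ⊤ L U₀
    (fun u _ a b => by simpa using B9Eq321LandauOrthogonalZd.trace_mul_conjR τ hτt u a b) (fun _ _ _ => Subgroup.mem_top _) hP lam Λs μ
  simpa using key

/-- ★★ **`N^per(Q′(U₀)) = W^⊥` ON THE TORUS**: a periodic `λ` is orthogonal to every periodic `Q′(U₀)ᵀμ` iff `Q′_j(U₀)λ = 0` on the `Λ_j` (⇐ by the cell transpose
identity; ⇒ by testing against the LEVEL-PERIODIC one-class multiplier `𝟙_{[y₀]}·b` at `(j, y₀)` and the non-degeneracy of `τ`, reading `y₀ ∈ Λ_j` on its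
representative in the level-`j` cell — whence the level-periodicity hypothesis on `Λ_j`). Hypotheses: `τ` tracial and non-degenerate, `P ≠ 0`, `L ≥ 1`, `Lᵐ ∣ P`,
`U₀`, `λ` `P`-periodic, `Λ_j` `(P∕Lʲ)`-periodic. [cite: Balaban1985BackgroundPropagators, (3.21) p.394, (3.19) p.393, (3.24) p.394; Balaban1985RegularSpaces, (1.38) p.82, p.77] -/
theorem nullSubPer_eq_orthogonal_multSubPer [NeZero P] (hτt : ∀ a b : 𝔸, τ (a * b) = τ (b * a))
    (hτn : ∀ a : 𝔸, (∀ b : 𝔸, τ (a * b) = 0) → a = 0) (hL : 1 ≤ L) (hU : IsPeriodic P U₀) (hP : L ^ m ∣ P)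
    (hΛ : ∀ j, j ≤ m → IsPeriodic (P / L ^ j) fun y => y ∈ Λs j) :
    nullSubPer P L m Λs U₀ = (pairPer τ P).orthogonal (multSubPer P L m Λs U₀) := by
  classical
  ext lam
  rw [LinearMap.BilinForm.mem_orthogonal_iff]
  constructor
  · -- `λ ∈ N` ⊥ every `Q′ᵀμ`
    rintro hlam g ⟨μ, -, hμ⟩
    show pairPer τ P g lam = 0
    rw [(pairPer_isSymm τ P hτt).eq g lam, pairPer_apply]
    have h1 : ∑ x ∈ box (d := d) P, τ ((lam : Site d → 𝔸) x * (g : Site d → 𝔸) x) =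
        ∑ x ∈ box (d := d) P, τ ((lam : Site d → 𝔸) x * QT L m Λs U₀ μ x) :=
      Finset.sum_congr rfl fun x _ => by rw [hμ x]
    rw [h1, sum_box_trace_mul_QT hτt hP (lam : Site d → 𝔸) μ]
    refine Finset.sum_eq_zero fun j hj => Finset.sum_eq_zero fun y _ => ?_
    have hjm : j ≤ m := Nat.lt_succ_iff.1 (Finset.mem_range.1 hj)
    by_cases hy : y ∈ Λs j
    · rw [hlam j hjm y hy, zero_mul, map_zero]
    · rw [Set.indicator_of_notMem hy, mul_zero, map_zero]
  · -- ⊥ every `Q′ᵀμ` ⇒ `Q′_jλ = 0` on `Λ_j`: test the periodic one-class multiplier at `(j, ȳ₀)`, `ȳ₀` the representative of `y₀` in the level-`j` cell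
    intro h j hj y₀ hy₀
    -- pass to the representative `ȳ₀ ∈ [0, P∕Lʲ)ᵈ` (periodicity of `Q′_jλ` and of `Λ_j`)
    set Q : ℕ := P / L ^ j with hQ
    have hPQ : P = L ^ j * Q := eq_pow_mul_div_of_dvd hP hj
    haveI : NeZero Q := ⟨fun h0 => NeZero.ne P (by rw [hPQ, h0, mul_zero])⟩
    set z : Site d := tlift (tcls Q y₀) with hz
    have hzbox : z ∈ box (d := d) Q := tlift_mem_box _
    have hzΛ : z ∈ Λs j := (mem_iff_tlift_mem_of_isPeriodic (hΛ j hj) y₀).1 hy₀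
    have hper : IsPeriodic Q (QprimeIter (zdBlocking d L) (bgT L U₀) j (lam : Site d → 𝔸)) := isPeriodic_QprimeIter hU lam.2 hPQ
    rw [← IsPeriodic.apply_tlift hper y₀]
    show QprimeIter (zdBlocking d L) (bgT L U₀) j (lam : Site d → 𝔸) z = 0
    refine hτn _ fun b => ?_
    -- the test multiplier: level `j`, the periodic one-class function at `z`
    let μ : ℕ → Site d → 𝔸 := fun j' => if j' = j then pdelta Q z b else 0
    have hμp : ∀ j', j' ≤ m → IsPeriodic (P / L ^ j') (μ j') := by
      intro j' _
      by_cases hj' : j' = j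
      · subst hj'
        simp only [μ, if_pos rfl]
        exact pdelta_mem_perSubC (d := d) Q z b
      · simp only [μ, if_neg hj']
        exact fun _ _ => rfl
    have hgper : IsPeriodic P (QT L m Λs U₀ μ) := isPeriodic_QT hL hU hP hΛ hμp
    have hg : (⟨QT L m Λs U₀ μ, hgper⟩ : perSubC (𝔸 := 𝔸) (d := d) P) ∈ multSubPer P L m Λs U₀ := ⟨μ, hμp, fun _ => rfl⟩
    have h1 := h _ hg
    have h1' : pairPer τ P ⟨QT L m Λs U₀ μ, hgper⟩ lam = 0 := h1
    rw [(pairPer_isSymm τ P hτt).eq _ lam, pairPer_apply] at h1'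
    have h2 : ∑ x ∈ box (d := d) P, τ ((lam : Site d → 𝔸) x * QT L m Λs U₀ μ x) =
        ∑ j' ∈ Finset.range (m + 1), ∑ y ∈ box (d := d) (P / L ^ j'),
          τ (QprimeIter (zdBlocking d L) (bgT L U₀) j' (lam : Site d → 𝔸) y * (Λs j').indicator (μ j') y) :=
      sum_box_trace_mul_QT hτt hP (lam : Site d → 𝔸) μ
    rw [h2] at h1'
    -- only the level `j` survives
    rw [Finset.sum_eq_single j (fun j' _ hj' => by
        have : (Λs j').indicator (μ j') = 0 := by
          funext y
          by_cases hy : y ∈ Λs j'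
          · simp only [μ, Set.indicator_of_mem hy, if_neg hj', Pi.zero_apply]
          · simp only [Set.indicator_of_notMem hy, Pi.zero_apply]
        simp only [this, Pi.zero_apply, mul_zero, map_zero, Finset.sum_const_zero])
      (fun hj' => absurd (Finset.mem_range.2 (Nat.lt_succ_of_le hj)) hj')] at h1'
    -- at level `j`: the indicator is read through `pdelta`, and the cell sum picks `z`
    have h3 : ∑ y ∈ box (d := d) (P / L ^ j), τ (QprimeIter (zdBlocking d L) (bgT L U₀) j (lam : Site d → 𝔸) y * (Λs j).indicator (μ j) y) =
        ∑ y ∈ box (d := d) Q, τ (QprimeIter (zdBlocking d L) (bgT L U₀) j (lam : Site d → 𝔸) y * pdelta Q z ((Λs j).indicator (fun _ => b) y) y) := by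
      rw [← hQ]
      refine Finset.sum_congr rfl fun y _ => ?_
      by_cases hy : y ∈ Λs j
      · simp only [μ, if_pos rfl, Set.indicator_of_mem hy]
      · simp only [Set.indicator_of_notMem hy, mul_zero, map_zero, pdelta]
        split_ifs <;> simp
    rw [h3] at h1'
    -- `pdelta Q z (𝟙_{Λ_j} b y) y = pdelta Q z b' y` only matters at `y = z` on the cell; compute the cell sum directly
    rw [Finset.sum_eq_single z (fun y hy hyz => by
        have hne : tcls Q y ≠ tcls Q z := fun h' => hyz (tcls_injOn_box hy hzbox h')
        simp only [pdelta, if_neg hne, mul_zero, map_zero]) (fun h' => absurd hzbox h')] at h1'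
    simpa [pdelta, Set.indicator_of_mem hzΛ] using h1'

end Subspaces

/-! ## §4  Orthogonality form on the cell ⇒ multiplier form at `Ω₀ = ℤᵈ`, and the equivalence -/

section Iff

variable {τ : 𝔸 →ₗ[ℂ] ℂ} {P L m : ℕ} [NeZero P] [NeZero L] {η : ℝ} {Λs : ℕ → Set (Site d)} {U₀ : Site d → Fin d → 𝔸ˣ}

/-- ★★ **ORTHOGONALITY FORM ON THE CELL ⇒ MULTIPLIER FORM AT `Ω₀ = ℤᵈ`** at every periodic background of units (fibre finite-dimensional, `τ` tracial and
non-degenerate, `P ≠ 0`, `L ≥ 1`, `Lᵐ ∣ P`, `U₀` and `A` `P`-periodic, `Λ_j` `(P∕Lʲ)`-periodic): if `Σ_{x∈[0,P)ᵈ} τ((Δ^η_{U₀}λ)(x)·(D^{η*}_{U₀}A)(x)) = 0` for every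
PERIODIC `λ` with `Q′_j(U₀)λ = 0` on `Λ_j` (`j ≤ m`), then `Δ^η_{U₀}D^{η*}_{U₀}A = Q′(U₀)ᵀμ` on ALL of `ℤᵈ` for some LEVEL-PERIODIC multiplier `μ` — in particular
`IsLandau138 L m η Set.univ Λs U₀ A`.  Proof: `g = Δ^η_{U₀}D^{η*}_{U₀}A` is periodic and lies in `(N^per)^⊥` (by the `τ`-symmetry of `Δ^η_{U₀}` on the cell), and
`(N^per)^⊥ = W^⊥⊥ = W` by §3 and finite-dimensional duality; the members of `W` are periodic transposes, equal to `g` everywhere.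
[cite: Balaban1985RegularSpaces, (1.38) p.82, p.77 («Ω_j = T_η»); Balaban1985BackgroundPropagators, (3.20)–(3.21) p.394, (3.23)–(3.24) p.394] -/
theorem isLandau138_univ_of_orthogonal [FiniteDimensional ℂ 𝔸] (hτt : ∀ a b : 𝔸, τ (a * b) = τ (b * a))
    (hτn : ∀ a : 𝔸, (∀ b : 𝔸, τ (a * b) = 0) → a = 0) (hL : 1 ≤ L) (hU : IsPeriodic P U₀) (hP : L ^ m ∣ P)
    (hΛ : ∀ j, j ≤ m → IsPeriodic (P / L ^ j) fun y => y ∈ Λs j) {A : Site d → Fin d → 𝔸} (hA : IsPeriodic P A)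
    (h : ∀ lam : Site d → 𝔸, IsPeriodic P lam →
      (∀ j, j ≤ m → ∀ y ∈ Λs j, QprimeIter (zdBlocking d L) (bgT L U₀) j lam y = 0) →
      ∑ x ∈ box (d := d) P, τ (covLap η U₀ lam x * covDivB η U₀ A x) = 0) :
    ∃ μ : ℕ → Site d → 𝔸, (∀ j, j ≤ m → IsPeriodic (P / L ^ j) (μ j)) ∧
      ∀ x, covLap η U₀ (covDivB η U₀ A) x = QT L m Λs U₀ μ x := by
  classical
  haveI := finiteDimensional_perSubC (𝔸 := 𝔸) (d := d) P
  set φ : Site d → 𝔸 := covDivB η U₀ A with hφ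
  have hφp : IsPeriodic P φ := B9Eq321LandauProjectionZdPer.isPeriodic_covDivB hU hA
  have hgp : IsPeriodic P (covLap η U₀ φ) := B9Eq321LandauProjectionZdPer.isPeriodic_covLap hU hφp
  set g : perSubC (𝔸 := 𝔸) (d := d) P := ⟨covLap η U₀ φ, hgp⟩ with hg
  -- `g ∈ (N^per)^⊥`
  have hgorth : g ∈ (pairPer τ P).orthogonal (nullSubPer P L m Λs U₀) := by
    rw [LinearMap.BilinForm.mem_orthogonal_iff]
    intro lam hlam
    show pairPer τ P lam g = 0
    rw [pairPer_apply]
    -- `Σ_cell τ(λ · Δφ) = Σ_cell τ(Δλ · φ) = 0`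
    have key := sum_box_pair_covLap_symm ((LinearMap.mul ℝ 𝔸).compr₂ (τ.restrictScalars ℝ)) ⊤ P η U₀
      (fun u _ a b => by simpa using B9Eq321LandauOrthogonalZd.trace_mul_conjR τ hτt u a b) (fun _ _ => Subgroup.mem_top _) hU hφp lam.2
    have key' : ∑ x ∈ box (d := d) P, τ ((lam : Site d → 𝔸) x * covLap η U₀ φ x) =
        ∑ x ∈ box (d := d) P, τ (covLap η U₀ (lam : Site d → 𝔸) x * φ x) := by
      simpa using key
    show ∑ x ∈ box (d := d) P, τ ((lam : Site d → 𝔸) x * covLap η U₀ φ x) = 0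
    rw [key']
    exact h _ lam.2 hlam
  -- `(N^per)^⊥ = W^⊥⊥ = W`
  rw [nullSubPer_eq_orthogonal_multSubPer (τ := τ) hτt hτn hL hU hP hΛ,
    LinearMap.BilinForm.orthogonal_orthogonal (pairPer_nondegenerate τ P hτt hτn) (pairPer_isSymm τ P hτt).isRefl] at hgorth
  obtain ⟨μ, hμp, hμ⟩ := hgorth
  exact ⟨μ, hμp, fun x => hμ x⟩

/-- ★★ **… HENCE THE LANDAU CONDITION OF RECORD AT `Ω₀ = ℤᵈ`**: under the hypotheses of `isLandau138_univ_of_orthogonal`, `IsLandau138 L m η Set.univ Λs U₀ A`.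
[cite: Balaban1985RegularSpaces, (1.38) p.82, p.77; Balaban1985BackgroundPropagators, (3.20)–(3.21) p.394] -/
theorem isLandau138_univ_of_orthogonal' [FiniteDimensional ℂ 𝔸] (hτt : ∀ a b : 𝔸, τ (a * b) = τ (b * a))
    (hτn : ∀ a : 𝔸, (∀ b : 𝔸, τ (a * b) = 0) → a = 0) (hL : 1 ≤ L) (hU : IsPeriodic P U₀) (hP : L ^ m ∣ P)
    (hΛ : ∀ j, j ≤ m → IsPeriodic (P / L ^ j) fun y => y ∈ Λs j) {A : Site d → Fin d → 𝔸} (hA : IsPeriodic P A)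
    (h : ∀ lam : Site d → 𝔸, IsPeriodic P lam →
      (∀ j, j ≤ m → ∀ y ∈ Λs j, QprimeIter (zdBlocking d L) (bgT L U₀) j lam y = 0) →
      ∑ x ∈ box (d := d) P, τ (covLap η U₀ lam x * covDivB η U₀ A x) = 0) :
    IsLandau138 L m η (Set.univ : Set (Site d)) Λs U₀ A := by
  obtain ⟨μ, -, hμ⟩ := isLandau138_univ_of_orthogonal (η := η) hτt hτn hL hU hP hΛ hA h
  refine ⟨μ, fun x _ => ?_⟩
  rw [Set.indicator_univ]
  exact hμ x

/-- ★★★ **ON THE TORUS THE MULTIPLIER FORM (1.38) OF RECORD AT `Ω₀ = ℤᵈ` IS EQUIVALENT TO PRINT's ORTHOGONALITY FORM (3.21)** at EVERY periodic background of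
units `U₀` (`P ≠ 0`, `L ≥ 1`, `Lᵐ ∣ P`, `Λ_j` `(P∕Lʲ)`-periodic, `A` periodic, fibre finite-dimensional with a tracial non-degenerate `τ`):
`IsLandau138 L m η Set.univ Λs U₀ A` ⟺ `D^{η*}_{U₀}A ⊥_τ Δ^η_{U₀}N^per(Q′(U₀))` over the cell `[0,P)ᵈ` — «R(U₀)D^{η*}_{U₀}A = 0» on `T_P` with NO (3.25)-inverse ∕
Thm 3.11 in the identification. [cite: Balaban1985RegularSpaces, (1.38) p.82, (1.42) p.83, p.77 («Ω_j = T_η»); Balaban1985BackgroundPropagators, (3.20)–(3.21) p.394, (3.25) p.394] -/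
theorem isLandau138_univ_iff_orthogonal [FiniteDimensional ℂ 𝔸] (hτt : ∀ a b : 𝔸, τ (a * b) = τ (b * a))
    (hτn : ∀ a : 𝔸, (∀ b : 𝔸, τ (a * b) = 0) → a = 0) (hL : 1 ≤ L) (hU : IsPeriodic P U₀) (hP : L ^ m ∣ P)
    (hΛ : ∀ j, j ≤ m → IsPeriodic (P / L ^ j) fun y => y ∈ Λs j) {A : Site d → Fin d → 𝔸} (hA : IsPeriodic P A) :
    IsLandau138 L m η (Set.univ : Set (Site d)) Λs U₀ A ↔
      ∀ lam : Site d → 𝔸, IsPeriodic P lam →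
        (∀ j, j ≤ m → ∀ y ∈ Λs j, QprimeIter (zdBlocking d L) (bgT L U₀) j lam y = 0) →
        ∑ x ∈ box (d := d) P, τ (covLap η U₀ lam x * covDivB η U₀ A x) = 0 :=
  ⟨fun hL138 _ hlam hQ => sum_box_trace_covLap_mul_covDivB_eq_zero_of_isLandau138 τ hτt hU hP hA hL138 hlam hQ,
    isLandau138_univ_of_orthogonal' hτt hτn hL hU hP hΛ hA⟩

end Iff

end Literature.MathematicalPhysics.QuantumFieldTheory.Balaban1983to89.B9Eq321LandauMultiplierIffZdPer

end
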